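import Summits.KontsevichZagierPeriods.KontsevichZagierPeriods.Theorems.HurwitzMicroSectorsNormalFormPrincipleDimOneCells
import Summits.KontsevichZagierPeriods.KontsevichZagierPeriods.Theorems.AbelContractionRealHyperellipticSectorPortDimOneRatMultiple

/-!
# Route AbelContraction — `RealHyperellipticSector` (crux stmt-KontsevichZagierPeriods-12475):
# the Baker sector, I — bounded pieces with real-algebraic rational integrands are mixed normal forms

Helper file of the line `Lines/birth.lean` (stub `stub_bakerAlg`, `--supports` the crux): the
`K`-coefficient version (`K = algebraicClosure ℚ ℝ`) of the tree's `…DimOnePiece` / `…DimOneAssembly`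
front end, inside the budget `KZ.relationsLE 1`. A representation of dimension one whose integrand
is, ON ITS DOMAIN, a quotient `P/Q` (`P, Q ∈ K[X]`, `Q ≠ 0` there) is a mixed normal form in
`FormalRep ⧸ relationsLE 1` as soon as its domain is BOUNDED: reduced form on an open interval
(`exists_reducedK_interval`: no pole of the reduced form on the CLOSED interval, by absolute
integrability), ONE affine move of dimension `1` to the unit slab and `Port.Dlog.nfD_of_algK`
(`nfD_of_kRational_interval(_any)`), cuts at the algebraic break points of the `ℚ`-semialgebraic
domain (`nfD_of_kRational_breakpoints`, `nfD_of_kRational_bounded` — registered sub-goal).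

References: M. Kontsevich, D. Zagier, *Periods* (2001), §1.2 rules (1), (2) [KontsevichZagier2001];
J. Viu-Sos (2021), §2.3. No definitions are introduced.
-/

noncomputable section

open MeasureTheory Set
open scoped Polynomial
open Literature.NumberTheory.Transcendental Literature.NumberTheory.Transcendental.KZ
open Literature.ModelTheory.ExponentialFields (IsSemialgebraic)

namespace Summit.KontsevichZagierPeriods.AbelContraction.RealHyperellipticSector

namespace Baker

open Summit.KontsevichZagierPeriods.HurwitzMicroSectors.NormalFormPrinciple.Negative
  (integrableOn_fin_one)
open Summit.KontsevichZagierPeriods.KontsevichZagierPeriods.BetaCancellationNegative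
  (volume_setOf_apply_eq_zero)
open Summit.KontsevichZagierPeriods.HurwitzMicroSectors.NormalFormPrinciple.PiBox
  (AlgSplitK5.exists_repK_unit)
open Summit.KontsevichZagierPeriods.HurwitzMicroSectors.NormalFormPrinciple.PiBox.Dlog
  (image_affine_slab_of_pos exists_algebraic_breakpoints)
open Summit.KontsevichZagierPeriods.AbelContraction.RealHyperellipticSector.Port.Dlog
  (nfD_zero nfD_add nfD_of_algK slab_empty_mem_relationsLE)

variable {RA : ℝ → ℝ → ℝ → IntegralRep 1} {ZA : ℝ → IntegralRep 0} {RG : ℝ → ℝ → IntegralRep 1}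

/-! ## Reduced form on a bounded interval, coefficients in `K` -/

/-- Evaluation of the real image of a `K`-polynomial is `Polynomial.aeval`. [folklore] -/
theorem eval_map_algebraMapK (R : (algebraicClosure ℚ ℝ)[X]) (t : ℝ) :
    (R.map (algebraMap (algebraicClosure ℚ ℝ) ℝ)).eval t = Polynomial.aeval t R := by
  rw [Polynomial.eval_map, ← Polynomial.aeval_def]

/-- **Reduced form on a bounded interval, real algebraic coefficients**: on the slab over `(a,b)`
an integrand `P/Q` (`P, Q ∈ K[X]`, `Q ≠ 0` on `(a,b)`) equals `P'/Q'` with `P', Q' ∈ K[X]` coprime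
and `Q' ≠ 0` on the CLOSED `[a,b]` (a pole of the reduced form at an end point contradicts absolute
integrability, `KZ.rootMultiplicity_le_of_integrableOn`). [cite: ViuSos2021, §2.3] -/
theorem exists_reducedK_interval {a b : ℝ} (hab : a < b) (N : IntegralRep 1)
    (hNd : N.domain = {x | x 0 ∈ Set.Ioo a b}) (P₀ Q₀ : (algebraicClosure ℚ ℝ)[X])
    (hQ₀t : ∀ t ∈ Set.Ioo a b, (Polynomial.aeval t Q₀ : ℝ) ≠ 0)
    (hEq₀ : EqOn N.integrand (fun x => (Polynomial.aeval (x 0) P₀ : ℝ) / Polynomial.aeval (x 0) Q₀)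
      N.domain) :
    ∃ P Q : (algebraicClosure ℚ ℝ)[X], Q ≠ 0 ∧ (∀ t ∈ Set.Icc a b, (Polynomial.aeval t Q : ℝ) ≠ 0) ∧
      EqOn N.integrand (fun x => (Polynomial.aeval (x 0) P : ℝ) / Polynomial.aeval (x 0) Q) N.domain := by
  -- adapted from `PiBox.Dlog.exists_reduced_of_isRational_interval` (coefficients in `ℚ`)
  have hmid : (a + b) / 2 ∈ Set.Ioo a b := ⟨by linarith, by linarith⟩
  have hQ₀0 : Q₀ ≠ 0 := fun h => hQ₀t _ hmid (by rw [h, map_zero])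
  -- divide by the gcd
  set G := EuclideanDomain.gcd P₀ Q₀ with hG
  have hG0 : G ≠ 0 := fun h => hQ₀0 (EuclideanDomain.gcd_eq_zero_iff.mp h).2
  set P : (algebraicClosure ℚ ℝ)[X] := P₀ / G with hP_def
  set Q : (algebraicClosure ℚ ℝ)[X] := Q₀ / G with hQ_def
  have hP : P₀ = G * P := (EuclideanDomain.mul_div_cancel' hG0 (EuclideanDomain.gcd_dvd_left P₀ Q₀)).symm
  have hQ : Q₀ = G * Q := (EuclideanDomain.mul_div_cancel' hG0 (EuclideanDomain.gcd_dvd_right P₀ Q₀)).symm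
  have hQ0 : Q ≠ 0 := fun h => hQ₀0 (by rw [hQ, h, mul_zero])
  have hcop : IsCoprime P Q := by
    have h := EuclideanDomain.gcd_eq_gcd_ab P₀ Q₀
    rw [← hG] at h
    refine ⟨EuclideanDomain.gcdA P₀ Q₀, EuclideanDomain.gcdB P₀ Q₀, mul_left_cancel₀ hG0 ?_⟩
    calc G * (EuclideanDomain.gcdA P₀ Q₀ * P + EuclideanDomain.gcdB P₀ Q₀ * Q)
        = (G * P) * EuclideanDomain.gcdA P₀ Q₀ + (G * Q) * EuclideanDomain.gcdB P₀ Q₀ := by ring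
      _ = G := by rw [← hP, ← hQ, ← h]
      _ = G * 1 := (mul_one G).symm
  have hGt : ∀ t ∈ Set.Ioo a b, (Polynomial.aeval t G : ℝ) ≠ 0 := by
    intro t ht h; apply hQ₀t t ht; rw [hQ, map_mul, h, zero_mul]
  have hEq' : EqOn N.integrand (fun x => (Polynomial.aeval (x 0) P : ℝ) / Polynomial.aeval (x 0) Q)
      N.domain := by
    intro x hx
    rw [hEq₀ hx]
    have hx' : x 0 ∈ Set.Ioo a b := by rw [hNd] at hx; exact hx
    show (Polynomial.aeval (x 0) P₀ : ℝ) / Polynomial.aeval (x 0) Q₀ = _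
    rw [hP, hQ, map_mul, map_mul, mul_div_mul_left _ _ (hGt (x 0) hx')]
  -- integrability of the reduced integrand on the open interval
  have hint : IntegrableOn (fun t : ℝ => (Polynomial.aeval t P : ℝ) / Polynomial.aeval t Q) (Set.Ioo a b) := by
    have h1 : IntegrableOn (fun x : Fin 1 → ℝ => (Polynomial.aeval (x 0) P : ℝ) / Polynomial.aeval (x 0) Q)
        N.domain :=
      N.integrableOn.congr_fun hEq' (IsSemialgebraic.measurableSet_holds N.isSemialgebraic_domain)
    rw [hNd, integrableOn_fin_one] at h1
    exact h1
  -- no zero of `Q` on the closed interval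
  have hnoroot : ∀ t ∈ Set.Icc a b, (Polynomial.aeval t Q : ℝ) ≠ 0 := by
    intro t ht hQt0
    by_cases hP0 : P = 0
    · -- `P = 0`: `Q` is a unit, a nonzero constant
      have hu : IsUnit Q := by rwa [hP0, isCoprime_zero_left] at hcop
      obtain ⟨c, hc, hcQ⟩ := Polynomial.isUnit_iff.mp hu
      apply hc.ne_zero
      have h : (Polynomial.aeval t (Polynomial.C c) : ℝ) = 0 := by rw [hcQ]; exact hQt0
      rw [Polynomial.aeval_C] at h
      exact (algebraMap (algebraicClosure ℚ ℝ) ℝ).injective (by rw [h, map_zero])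
    · -- `P ≠ 0`: a zero of `Q` in `[a,b]` is a zero of `P` (integrability), contradicting coprimality
      set Pr := P.map (algebraMap (algebraicClosure ℚ ℝ) ℝ) with hPr
      set Qr := Q.map (algebraMap (algebraicClosure ℚ ℝ) ℝ) with hQr
      have hPr0 : Pr ≠ 0 :=
        (Polynomial.map_ne_zero_iff (algebraMap (algebraicClosure ℚ ℝ) ℝ).injective).mpr hP0
      have hQr0 : Qr ≠ 0 :=
        (Polynomial.map_ne_zero_iff (algebraMap (algebraicClosure ℚ ℝ) ℝ).injective).mpr hQ0
      have hint' : IntegrableOn (fun t : ℝ => Pr.eval t / Qr.eval t) (Set.Ioo a b) := by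
        simp_rw [hPr, hQr, eval_map_algebraMapK]; exact hint
      have hle := rootMultiplicity_le_of_integrableOn hPr0 hQr0 hab ht hint'
      have hQroot : Qr.IsRoot t := by rw [Polynomial.IsRoot.def, hQr, eval_map_algebraMapK]; exact hQt0
      have hpos : 0 < Polynomial.rootMultiplicity t Qr := (Polynomial.rootMultiplicity_pos hQr0).mpr hQroot
      have hProot : Pr.IsRoot t := (Polynomial.rootMultiplicity_pos hPr0).mp (lt_of_lt_of_le hpos hle)
      have hPt0 : (Polynomial.aeval t P : ℝ) = 0 := by
        rw [← eval_map_algebraMapK]; exact hProot.eq_zero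
      obtain ⟨u, v, huv⟩ := hcop
      have h := congrArg (Polynomial.aeval t) huv
      rw [map_add, map_mul, map_mul, hPt0, hQt0, mul_zero, mul_zero, add_zero, map_one] at h
      exact zero_ne_one h
  exact ⟨P, Q, hQ0, hnoroot, hEq'⟩

/-! ## An interval with algebraic ends and a `K`-rational integrand is a mixed normal form -/

/-- **A representation with `K`-rational integrand on a bounded interval with real algebraic end
points `a < b` is a mixed normal form** in `FormalRep ⧸ relationsLE 1`: reduced form
(`exists_reducedK_interval`), ONE affine move of dimension `1`, `x = a + (b−a)t`, with algebraic
coefficients to the unit slab (`Port.Dlog.SiegeK3.affineA_sub_mem_relationsLE`), whose pull-back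
integrand `(b−a)P(a+(b−a)t)/Q(a+(b−a)t)` is `K`-rational and pole-free on `[0,1]`, then
`Port.Dlog.nfD_of_algK` (inside the budget `relationsLE 1`). [cite: KontsevichZagier2001, §1.2 rules (1), (2)] -/
theorem nfD_of_kRational_interval
    (hR : ∀ a b c, IsAlgebraic ℚ a → IsAlgebraic ℚ b → IsAlgebraic ℚ c → 0 < a →
      (RA a b c).domain = {x | x 0 ∈ Set.Ioo a b} ∧ (RA a b c).integrand = fun x => c / x 0)
    (hZ : ∀ r, IsAlgebraic ℚ r → (ZA r).domain = univ ∧ (ZA r).integrand = fun _ => r)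
    (hRG : ∀ t d, IsAlgebraic ℚ t → IsAlgebraic ℚ d →
      (RG t d).domain = {x | x 0 ∈ Set.Ioo 0 t} ∧ (RG t d).integrand = fun x => d / (1 + x 0 ^ 2))
    {a b : ℝ} (ha : IsAlgebraic ℚ a) (hb : IsAlgebraic ℚ b) (hab : a < b)
    (N : IntegralRep 1) (hNd : N.domain = {x | x 0 ∈ Set.Ioo a b}) (P₀ Q₀ : (algebraicClosure ℚ ℝ)[X])
    (hQ₀ : ∀ p ∈ N.domain, (Polynomial.aeval (p 0) Q₀ : ℝ) ≠ 0)
    (hNi : EqOn N.integrand (fun x => (Polynomial.aeval (x 0) P₀ : ℝ) / Polynomial.aeval (x 0) Q₀)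
      N.domain) :
    ∃ (r : ℝ) (k : ℕ) (u c : Fin k → ℝ) (k' : ℕ) (t d : Fin k' → ℝ), IsAlgebraic ℚ r ∧ (∀ j, 1 < u j) ∧
      (∀ j, IsAlgebraic ℚ (u j)) ∧ (∀ j, IsAlgebraic ℚ (c j)) ∧ (∀ l, 0 ≤ t l) ∧
      (∀ l, IsAlgebraic ℚ (t l)) ∧ (∀ l, IsAlgebraic ℚ (d l)) ∧
      QuotientAddGroup.mk' (relationsLE 1) (of N) = QuotientAddGroup.mk' (relationsLE 1) (of (ZA r)) +
        ∑ j, QuotientAddGroup.mk' (relationsLE 1) (of (RA 1 (u j) (c j))) +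
        ∑ l, QuotientAddGroup.mk' (relationsLE 1) (of (RG (t l) (d l))) := by
  -- adapted from `PiBox.Dlog.nfD_of_isRational_interval` (coefficients in `ℚ`)
  obtain ⟨P, Q, hQ0, hQab, hNi'⟩ := exists_reducedK_interval hab N hNd P₀ Q₀
    (fun t ht => hQ₀ (fun _ => t) (by rw [hNd]; exact ht)) hNi
  have hs : 0 < b - a := sub_pos.mpr hab
  have hsA : IsAlgebraic ℚ (b - a) := hb.sub ha
  -- the algebraic data as elements of `K`
  set a' : algebraicClosure ℚ ℝ := ⟨a, mem_algebraicClosure_iff.mpr ha⟩ with ha'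
  set s' : algebraicClosure ℚ ℝ := ⟨b - a, mem_algebraicClosure_iff.mpr hsA⟩ with hs'
  -- the pulled-back integrand over `K`
  set Φp : (algebraicClosure ℚ ℝ)[X] := Polynomial.C a' + Polynomial.C s' * Polynomial.X with hΦp
  set Pt : (algebraicClosure ℚ ℝ)[X] := Polynomial.C s' * P.comp Φp with hPt
  set Qt : (algebraicClosure ℚ ℝ)[X] := Q.comp Φp with hQt
  have hΦev : ∀ t : ℝ, (Polynomial.aeval t Φp : ℝ) = a + (b - a) * t := by
    intro t
    rw [hΦp, map_add, map_mul, Polynomial.aeval_C, Polynomial.aeval_C, Polynomial.aeval_X]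
    rfl
  have hQtev : ∀ t : ℝ, (Polynomial.aeval t Qt : ℝ) = Polynomial.aeval (a + (b - a) * t) Q := fun t => by
    rw [hQt, Polynomial.aeval_comp, hΦev]
  have hPtev : ∀ t : ℝ, (Polynomial.aeval t Pt : ℝ) = (b - a) * Polynomial.aeval (a + (b - a) * t) P := by
    intro t
    rw [hPt, map_mul, Polynomial.aeval_C, Polynomial.aeval_comp, hΦev]
    rfl
  have hmem : ∀ t ∈ Set.Icc (0:ℝ) 1, a + (b - a) * t ∈ Set.Icc a b := by
    intro t ht; constructor <;> nlinarith [ht.1, ht.2, hs]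
  have hQt01 : ∀ t ∈ Set.Icc (0:ℝ) 1, (Polynomial.aeval t Qt : ℝ) ≠ 0 := fun t ht => by
    rw [hQtev]; exact hQab _ (hmem t ht)
  obtain ⟨T, hTd, hTi⟩ := AlgSplitK5.exists_repK_unit Pt Qt hQt01
  -- the affine move `x = (b - a) y + a` (rule 2 among representations of dimension `1`)
  have hmove : of T - of N ∈ relationsLE 1 := by
    refine Port.Dlog.SiegeK3.affineA_sub_mem_relationsLE (s := b - a) (t := a) hsA ha hs.ne' T N
      (fun y => (Polynomial.aeval y P : ℝ) / Polynomial.aeval y Q) ?_ hNi' fun x _ => ?_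
    · rw [hTd, image_affine_slab_of_pos hs, hNd, mul_zero, zero_add, mul_one, sub_add_cancel]
    · rw [hTi, abs_of_pos hs]
      simp only
      rw [hPtev, hQtev, show a + (b - a) * x 0 = (b - a) * x 0 + a from add_comm _ _]
      ring
  have hcls : QuotientAddGroup.mk' (relationsLE 1) (of N) = QuotientAddGroup.mk' (relationsLE 1) (of T) := by
    rw [← QuotientAddGroup.eq_zero_iff] at hmove
    change QuotientAddGroup.mk' (relationsLE 1) _ = 0 at hmove
    rw [map_sub, sub_eq_zero] at hmove
    exact hmove.symm
  rw [hcls]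
  exact nfD_of_algK hR hZ hRG Pt Qt hQt01 T hTd (by rw [hTi]; exact fun _ _ => rfl)

/-- **Any bounded interval with algebraic ends**, `K`-rational integrand (the empty slab, `b ≤ a`,
being the zero class) (inside the budget `relationsLE 1`). [cite: KontsevichZagier2001, §1.2 rules (1), (2)] -/
theorem nfD_of_kRational_interval_any
    (hR : ∀ a b c, IsAlgebraic ℚ a → IsAlgebraic ℚ b → IsAlgebraic ℚ c → 0 < a →
      (RA a b c).domain = {x | x 0 ∈ Set.Ioo a b} ∧ (RA a b c).integrand = fun x => c / x 0)
    (hZ : ∀ r, IsAlgebraic ℚ r → (ZA r).domain = univ ∧ (ZA r).integrand = fun _ => r)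
    (hRG : ∀ t d, IsAlgebraic ℚ t → IsAlgebraic ℚ d →
      (RG t d).domain = {x | x 0 ∈ Set.Ioo 0 t} ∧ (RG t d).integrand = fun x => d / (1 + x 0 ^ 2))
    {a b : ℝ} (ha : IsAlgebraic ℚ a) (hb : IsAlgebraic ℚ b)
    (N : IntegralRep 1) (hNd : N.domain = {x | x 0 ∈ Set.Ioo a b}) (P₀ Q₀ : (algebraicClosure ℚ ℝ)[X])
    (hQ₀ : ∀ p ∈ N.domain, (Polynomial.aeval (p 0) Q₀ : ℝ) ≠ 0)
    (hNi : EqOn N.integrand (fun x => (Polynomial.aeval (x 0) P₀ : ℝ) / Polynomial.aeval (x 0) Q₀)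
      N.domain) :
    ∃ (r : ℝ) (k : ℕ) (u c : Fin k → ℝ) (k' : ℕ) (t d : Fin k' → ℝ), IsAlgebraic ℚ r ∧ (∀ j, 1 < u j) ∧
      (∀ j, IsAlgebraic ℚ (u j)) ∧ (∀ j, IsAlgebraic ℚ (c j)) ∧ (∀ l, 0 ≤ t l) ∧
      (∀ l, IsAlgebraic ℚ (t l)) ∧ (∀ l, IsAlgebraic ℚ (d l)) ∧
      QuotientAddGroup.mk' (relationsLE 1) (of N) = QuotientAddGroup.mk' (relationsLE 1) (of (ZA r)) +
        ∑ j, QuotientAddGroup.mk' (relationsLE 1) (of (RA 1 (u j) (c j))) +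
        ∑ l, QuotientAddGroup.mk' (relationsLE 1) (of (RG (t l) (d l))) := by
  by_cases hab : a < b
  · exact nfD_of_kRational_interval hR hZ hRG ha hb hab N hNd P₀ Q₀ hQ₀ hNi
  · have h0 : QuotientAddGroup.mk' (relationsLE 1) (of N) = 0 :=
      (QuotientAddGroup.eq_zero_iff _).mpr (slab_empty_mem_relationsLE N hNd (not_lt.mp hab))
    rw [h0]; exact nfD_zero hZ

/-! ## Cutting a bounded piece at algebraic break points -/

/-- **Decomposition at algebraic break points, `K`-rational integrand**: if the domain of `N` lies
in the slab over `(α, β)` (algebraic ends) and every sub-slab avoiding the finite algebraic set `F`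
lies in `N.domain` or misses it, the class of `N` is a mixed normal form in `FormalRep ⧸ relationsLE 1`
(cut at the largest break point — rule 1a in dimension `1`, a null cut —, right piece by
`nfD_of_kRational_interval_any`, recurse) (inside the budget `relationsLE 1`).
[cite: KontsevichZagier2001, §1.2 rules (1), (2)] -/
theorem nfD_of_kRational_breakpoints
    (hR : ∀ a b c, IsAlgebraic ℚ a → IsAlgebraic ℚ b → IsAlgebraic ℚ c → 0 < a →
      (RA a b c).domain = {x | x 0 ∈ Set.Ioo a b} ∧ (RA a b c).integrand = fun x => c / x 0)
    (hZ : ∀ r, IsAlgebraic ℚ r → (ZA r).domain = univ ∧ (ZA r).integrand = fun _ => r)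
    (hRG : ∀ t d, IsAlgebraic ℚ t → IsAlgebraic ℚ d →
      (RG t d).domain = {x | x 0 ∈ Set.Ioo 0 t} ∧ (RG t d).integrand = fun x => d / (1 + x 0 ^ 2))
    (P₀ Q₀ : (algebraicClosure ℚ ℝ)[X]) (F : Finset ℝ) :
    ∀ (α β : ℝ) (N : IntegralRep 1), IsAlgebraic ℚ α → IsAlgebraic ℚ β →
      (∀ z ∈ F, IsAlgebraic ℚ z) → (∀ z ∈ F, α < z ∧ z < β) →
      N.domain ⊆ {x | x 0 ∈ Set.Ioo α β} →
      (∀ p q : ℝ, α ≤ p → q ≤ β → (∀ z ∈ F, z ∉ Set.Ioo p q) →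
        {x : Fin 1 → ℝ | x 0 ∈ Set.Ioo p q} ⊆ N.domain ∨
          Disjoint {x : Fin 1 → ℝ | x 0 ∈ Set.Ioo p q} N.domain) →
      (∀ p ∈ N.domain, (Polynomial.aeval (p 0) Q₀ : ℝ) ≠ 0) →
      EqOn N.integrand (fun x => (Polynomial.aeval (x 0) P₀ : ℝ) / Polynomial.aeval (x 0) Q₀) N.domain →
      ∃ (r : ℝ) (k : ℕ) (u c : Fin k → ℝ) (k' : ℕ) (t d : Fin k' → ℝ), IsAlgebraic ℚ r ∧ (∀ j, 1 < u j) ∧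
        (∀ j, IsAlgebraic ℚ (u j)) ∧ (∀ j, IsAlgebraic ℚ (c j)) ∧ (∀ l, 0 ≤ t l) ∧
        (∀ l, IsAlgebraic ℚ (t l)) ∧ (∀ l, IsAlgebraic ℚ (d l)) ∧
        QuotientAddGroup.mk' (relationsLE 1) (of N) = QuotientAddGroup.mk' (relationsLE 1) (of (ZA r)) +
          ∑ j, QuotientAddGroup.mk' (relationsLE 1) (of (RA 1 (u j) (c j))) +
          ∑ l, QuotientAddGroup.mk' (relationsLE 1) (of (RG (t l) (d l))) := by
  -- adapted from `PiBox.Dlog.nfD_of_breakpoints` (integrands of KZ's rational shape over `ℚ`)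
  classical
  induction F using Finset.induction_on_max with
  | empty =>
    intro α β N hα hβ _ _ hsub hdich hQ hNi
    rcases hdich α β le_rfl le_rfl (fun z hz => (Finset.notMem_empty z hz).elim) with h | h
    · exact nfD_of_kRational_interval_any hR hZ hRG hα hβ N (Set.Subset.antisymm hsub h) P₀ Q₀ hQ hNi
    · have hNd : N.domain = ∅ :=
        Set.eq_empty_of_forall_notMem fun x hx => Set.disjoint_left.1 h (hsub hx) hx
      have h0 : QuotientAddGroup.mk' (relationsLE 1) (of N) = 0 :=
        (QuotientAddGroup.eq_zero_iff _).mpr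
          (Budget.of_mem_relationsLE_of_volume_eq_zero le_rfl N (by rw [hNd, measure_empty]))
      rw [h0]; exact nfD_zero hZ
  | insert z F hzmax ih =>
    intro α β N hα hβ halg hin hsub hdich hQ hNi
    have hzA : IsAlgebraic ℚ z := halg z (Finset.mem_insert_self z F)
    have hαz : α < z := (hin z (Finset.mem_insert_self z F)).1
    have hzβ : z < β := (hin z (Finset.mem_insert_self z F)).2
    -- the two pieces and the punctured domain
    have hSl : IsSemialgebraic ℚ (N.domain ∩ {x : Fin 1 → ℝ | x 0 < z}) :=
      N.isSemialgebraic_domain.inter (isSemialgebraic_setOf_apply_lt_const hzA 0)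
    have hSr : IsSemialgebraic ℚ (N.domain ∩ {x : Fin 1 → ℝ | z < x 0}) :=
      N.isSemialgebraic_domain.inter (isSemialgebraic_setOf_const_lt_apply hzA 0)
    have hSe : IsSemialgebraic ℚ (N.domain ∩ {x : Fin 1 → ℝ | x 0 = z}ᶜ) :=
      N.isSemialgebraic_domain.inter (isSemialgebraic_setOf_apply_eq_of_isAlgebraic hzA 0).compl
    set Nl := N.restrict _ hSl inter_subset_left with hNl
    set Nr := N.restrict _ hSr inter_subset_left with hNr
    set Ne := N.restrict _ hSe inter_subset_left with hNe
    -- `[N] ≡ [Ne] ≡ [Nl] + [Nr]` inside dimension `1`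
    have h1 : of N - of Ne ∈ relationsLE 1 := by
      refine Budget.of_sub_of_restrict_mem_relationsLE le_rfl N hSe inter_subset_left ?_
      refine measure_mono_null (fun x hx => ?_) (volume_setOf_apply_eq_zero (0 : Fin 1) z)
      by_contra hxz
      exact hx.2 ⟨hx.1, hxz⟩
    have h2 : of Ne - of Nl - of Nr ∈ relationsLE 1 := by
      refine Budget.domainAdd_mem_relationsLE le_rfl ?_ ?_ (fun _ _ => rfl) fun _ _ => rfl
      · ext x
        simp only [hNe, hNl, hNr, IntegralRep.domain_restrict, Set.mem_inter_iff, Set.mem_union,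
          Set.mem_compl_iff, Set.mem_setOf_eq]
        constructor
        · rintro ⟨hx, hxz⟩
          rcases lt_or_gt_of_ne hxz with h | h
          · exact Or.inl ⟨hx, h⟩
          · exact Or.inr ⟨hx, h⟩
        · rintro (⟨hx, h⟩ | ⟨hx, h⟩)
          · exact ⟨hx, h.ne⟩
          · exact ⟨hx, h.ne'⟩
      · have : Nl.domain ∩ Nr.domain = ∅ := by
          refine Set.eq_empty_of_forall_notMem fun x hx => ?_
          simp only [hNl, hNr, IntegralRep.domain_restrict, Set.mem_inter_iff, Set.mem_setOf_eq] at hx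
          linarith [hx.1.2, hx.2.2]
        rw [this, measure_empty]
    have hcls : QuotientAddGroup.mk' (relationsLE 1) (of N) =
        QuotientAddGroup.mk' (relationsLE 1) (of Nl) + QuotientAddGroup.mk' (relationsLE 1) (of Nr) := by
      have h := (relationsLE 1).add_mem h1 h2
      rw [← QuotientAddGroup.eq_zero_iff] at h
      change QuotientAddGroup.mk' (relationsLE 1) _ = 0 at h
      rw [map_add, map_sub, map_sub, map_sub] at h
      refine sub_eq_zero.mp ?_
      rw [← h]
      abel
    rw [hcls]
    refine nfD_add hZ ?_ ?_
    · -- the left piece: induction hypothesis inside `(α, z)`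
      refine ih α z Nl hα hzA (fun w hw => halg w (Finset.mem_insert_of_mem hw))
        (fun w hw => ⟨(hin w (Finset.mem_insert_of_mem hw)).1, hzmax w hw⟩) ?_ ?_
        (fun p hp => hQ p hp.1) (fun p hp => hNi hp.1)
      · intro x hx
        exact ⟨(hsub hx.1).1, hx.2⟩
      · intro p q hp hq havoid
        have havoid' : ∀ w ∈ insert z F, w ∉ Set.Ioo p q := by
          intro w hw
          rcases Finset.mem_insert.mp hw with rfl | hw
          · exact fun h => not_lt.mpr hq h.2
          · exact havoid w hw
        rcases hdich p q hp (hq.trans hzβ.le) havoid' with h | h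
        · refine Or.inl fun x hx => ⟨h hx, ?_⟩
          exact lt_of_lt_of_le hx.2 hq
        · exact Or.inr (h.mono_right inter_subset_left)
    · -- the right piece: the slab over `(z, β)` or nothing
      have havoid : ∀ w ∈ insert z F, w ∉ Set.Ioo z β := by
        intro w hw
        rcases Finset.mem_insert.mp hw with rfl | hw
        · exact fun h => lt_irrefl _ h.1
        · exact fun h => lt_asymm (hzmax w hw) h.1
      rcases hdich z β hαz.le le_rfl havoid with h | h
      · have hNrd : Nr.domain = {x | x 0 ∈ Set.Ioo z β} := by
          ext x
          simp only [hNr, IntegralRep.domain_restrict, Set.mem_inter_iff, Set.mem_setOf_eq, Set.mem_Ioo]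
          constructor
          · rintro ⟨hx, hzx⟩
            exact ⟨hzx, (hsub hx).2⟩
          · rintro hx
            exact ⟨h hx, hx.1⟩
        exact nfD_of_kRational_interval_any hR hZ hRG hzA hβ Nr hNrd P₀ Q₀
          (fun p hp => hQ p hp.1) (fun p hp => hNi hp.1)
      · have hNrd : Nr.domain = ∅ := by
          refine Set.eq_empty_of_forall_notMem fun x hx => ?_
          simp only [hNr, IntegralRep.domain_restrict, Set.mem_inter_iff, Set.mem_setOf_eq] at hx
          exact Set.disjoint_left.1 h (show x ∈ {x : Fin 1 → ℝ | x 0 ∈ Set.Ioo z β} from ⟨hx.2, (hsub hx.1).2⟩) hx.1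
        have h0 : QuotientAddGroup.mk' (relationsLE 1) (of Nr) = 0 :=
          (QuotientAddGroup.eq_zero_iff _).mpr
            (Budget.of_mem_relationsLE_of_volume_eq_zero le_rfl Nr (by rw [hNrd, measure_empty]))
        rw [h0]; exact nfD_zero hZ

/-- **A bounded piece with `K`-rational integrand is a mixed normal form** (registered sub-goal of
crux stmt-KontsevichZagierPeriods-12475): a representation of dimension one whose `ℚ`-semialgebraic
domain lies in a slab `(a, b)` with real algebraic ends and whose integrand is `P/Q` on the domain
(`P, Q ∈ K[X]`, `Q ≠ 0` there) is a mixed normal form in `FormalRep ⧸ relationsLE 1` — cut at the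
algebraic break points of the domain (`exists_algebraic_breakpoints`, `nfD_of_kRational_breakpoints`)
(inside the budget `relationsLE 1`). [cite: KontsevichZagier2001, §1.2 rules (1), (2)] -/
theorem nfD_of_kRational_bounded : ∀ {RA : ℝ → ℝ → ℝ → KZ.IntegralRep 1} {ZA : ℝ → KZ.IntegralRep 0}
    {RG : ℝ → ℝ → KZ.IntegralRep 1},
    (∀ a b c, IsAlgebraic ℚ a → IsAlgebraic ℚ b → IsAlgebraic ℚ c → 0 < a →
      (RA a b c).domain = {x | x 0 ∈ Set.Ioo a b} ∧ (RA a b c).integrand = fun x => c / x 0) →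
    (∀ r, IsAlgebraic ℚ r → (ZA r).domain = Set.univ ∧ (ZA r).integrand = fun _ => r) →
    (∀ t d, IsAlgebraic ℚ t → IsAlgebraic ℚ d →
      (RG t d).domain = {x | x 0 ∈ Set.Ioo 0 t} ∧ (RG t d).integrand = fun x => d / (1 + x 0 ^ 2)) →
    ∀ {a b : ℝ}, IsAlgebraic ℚ a → IsAlgebraic ℚ b →
    ∀ (N : KZ.IntegralRep 1), N.domain ⊆ {x | x 0 ∈ Set.Ioo a b} →
    ∀ (P Q : Polynomial (algebraicClosure ℚ ℝ)),
    (∀ p ∈ N.domain, (Polynomial.aeval (p 0) Q : ℝ) ≠ 0) →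
    Set.EqOn N.integrand (fun x => (Polynomial.aeval (x 0) P : ℝ) / Polynomial.aeval (x 0) Q)
      N.domain →
    ∃ (r : ℝ) (k : ℕ) (u c : Fin k → ℝ) (k' : ℕ) (t d : Fin k' → ℝ), IsAlgebraic ℚ r ∧
      (∀ j, 1 < u j) ∧ (∀ j, IsAlgebraic ℚ (u j)) ∧ (∀ j, IsAlgebraic ℚ (c j)) ∧ (∀ l, 0 ≤ t l) ∧
      (∀ l, IsAlgebraic ℚ (t l)) ∧ (∀ l, IsAlgebraic ℚ (d l)) ∧
      QuotientAddGroup.mk' (KZ.relationsLE 1) (KZ.of N) =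
        QuotientAddGroup.mk' (KZ.relationsLE 1) (KZ.of (ZA r)) +
          ∑ j, QuotientAddGroup.mk' (KZ.relationsLE 1) (KZ.of (RA 1 (u j) (c j))) +
          ∑ l, QuotientAddGroup.mk' (KZ.relationsLE 1) (KZ.of (RG (t l) (d l))) := by
  intro RA ZA RG hR hZ hRG a b ha hb N hsub P Q hQ hNi
  classical
  -- algebraic break points inside `(a, b)`
  obtain ⟨F₀, hF₀A, hF₀⟩ := exists_algebraic_breakpoints N.isSemialgebraic_domain
  set F : Finset ℝ := F₀.filter fun z => a < z ∧ z < b with hF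
  refine nfD_of_kRational_breakpoints hR hZ hRG P Q F a b N ha hb
    (fun z hz => hF₀A z (Finset.mem_filter.mp hz).1) (fun z hz => (Finset.mem_filter.mp hz).2)
    hsub (fun p q hp hq havoid => hF₀ p q fun z hz hzpq => ?_) hQ hNi
  exact havoid z (Finset.mem_filter.mpr ⟨hz, lt_of_le_of_lt hp hzpq.1, lt_of_lt_of_le hzpq.2 hq⟩) hzpq

end Baker

end Summit.KontsevichZagierPeriods.AbelContraction.RealHyperellipticSector

end
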